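import Summits.QuantumFields.YangMills.Theorems.FluctuationComparisonRegPrIntLS2BetaStageGaugeTower
import Summits.QuantumFields.YangMills.Theorems.FluctuationComparisonRegPrIntLS2BetaIterFlatTubeWLOG
import Summits.QuantumFields.YangMills.Theorems.FluctuationComparisonRegPrIntLS2BetaArcBondSplit
import Summits.QuantumFields.YangMills.Theorems.FluctuationComparisonRegPrIntLS2BetaSqrtLRecursion
import Summits.QuantumFields.YangMills.Theorems.FluctuationComparisonRegPrIntLS2BetaWhitneyHatLift
import Summits.QuantumFields.YangMills.Theorems.FluctuationComparisonRegPrIntLS2BetaFlatTubeDepthOneUniformTorus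
import Summits.QuantumFields.YangMills.Theorems.UnitScaleTiltProp7DescendJunction
import HarnessLib

/-!
# S2β · `hFlat` road (UV3-NODE §57.8 (B)) — DOCK-B, KERNEL EDITION: THE REGISTERED `hFlat` LETTER ⟸ ONE DISPLAYED ONE-LEVEL LETTER (H)
# «the relative field in ℓ²» + a lift with (R1), by the stage tower, the bond split, the variable-ratio recursion, the EXIT and the ENTRY — all by name

Cell `ym3-torus` (YM ladder rung R3 = continuum `SU(2)` Yang–Mills on the three-torus — a RUNG: NOT d = 4, NOT infinite volume, NOT a mass gap,
NOT Clay).  Width seat «width 17» `ym3-torus-px17` (gen 19), FREE px helper on crux `stmt-QuantumFields-20520`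
(`Theses.UnitScaleTilt.FluctuationComparisonRegPrIntL`); `--kind proof --supports stmt-QuantumFields-20520 --as helper`, count-neutral, DEFINITION-FREE
(0 `def`, 0 `instance`, 0 `notation`, 0 `sorry`, default heartbeats).  px8 g21 07:34:43Z (a) «GO on the ZERO-BYTE DOCK-B scratch … exactly the thing that
tells us which shapes still do not dock»; it came out sorry-free as a DOOR with ONE hypothesis, so it is filed (designer's first refusal honoured on the bus).

WHAT (UV3-NODE §57.8 (B) «NONLINEAR ASSEMBLY = A RECURSION», px8 g21; §63.4 docking list, px16 g20; §64.3 (R1) corrected, px12 g23's F₂ locate).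
For a good history `U` over the flat datum (`U ∈ fibre_{J,K}(1)`) and ANY family of lift maps `lift j : GaugeField P (j+1) SU(2) → GaugeField P j SU(2)`
with px12 g23's (R1) `Σ_b arc(lift X b)² ≤ L·Σ_e arc(X e)²` (✓`…WhitneyHatLift.sum_sq_arc_lift_le_three` supplies it for the geodesic hat lift):
* §1 EXIT — `residual_of_iter_eq` (a fine gauge acting trivially on the `(K−J)`-fold average of EVERY field is residual for `D_{J,K}`, ✓`descendTo_eq_fieldShift_iter`),
  `dist1_mul_inv_gaugeAct_one` (`dist1 (U ℓ·((g₀⁻¹ • 1) ℓ)⁻¹) = dist1 ((g₀ • U) ℓ)`, conjugation), ★`iInf_orbit_le_sum_sq_arc` (the REGISTERED orbit infimum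
  `⨅_w Σ_ℓ dist1(U ℓ·((w•1) ℓ)⁻¹)²` is at most the ARC energy `Σ_ℓ arc((g₀ • U) ℓ)²` of the gauged finest field at any residual `g₀⁻¹`; ✓`dist1_le_norm_logVec`).
* §2 ★★★ `dockB_inner` — THE (B) RECURSION END TO END for ONE run pair and ONE history: the stage tower `g` of ✓p816142 `exists_stageGaugeTower`
  (`U′_j := g_j • M^jU`, `V_j := lift_j U′_{j+1}`; comb axiality (T4), consistency (T5), residual top (T1)∕(T6)); the level energies
  `B_j := ‖arc U′_j‖_{ℓ²}` with `B_{K−J} = 0` (✓`iter_eq_one_of_mem_fibre_one`, ✓`logVec_su2Quat_one`); the bond split ✓p815834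
  `sqrt_sum_sq_norm_logVec_le` (`B_j ≤ ‖arc V_j‖₂ + (π∕2)‖dist1(U′_j·V_j⁻¹)‖₂`) and (R1) (`‖arc V_j‖₂ ≤ √L·B_{j+1}`); the DISPLAYED HYPOTHESIS (H)
  «ONE-LEVEL RELATIVE LETTER IN ℓ²»: for every gauge family with (T0)(T1)(T2)(T3)(T4)(T5) a profile `e ≥ 0`, `Σ_{j<K−J} e_j ≤ E`, with
      `(π∕2)·‖dist1 (U′_j · V_j⁻¹)‖_{ℓ²} ≤ √L·e_j·‖arc U′_{j+1}‖_{ℓ²} + C·(√L)^j·‖dist1 (U ∂·)‖_{ℓ²}`     (j < K − J);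
  hence `B_j ≤ √L(1 + e_j)B_{j+1} + C(√L)^j·F`, px16 g20's ✓p814904 `recursion_varRatio_sqrtL_le` ⟹ `B_0 ≤ exp E·C·F·(L^m−1)∕(L−1)`, ✓`hFlat_currency_of_recursion'`
  ⟹ `((L−1)∕(exp E·C))²·L^{−2m}·B_0² ≤ F² ≤ 4·A(U)` (✓`sum_dist1_sq_plaq_le_four_mul_wilsonAction4`), EXIT and ✓`minActionRegPr_one` ⟹ the in-tube `hFlat`
  inequality with the EXPLICIT `μ = ((L−1)∕(exp E·C))²∕4`.
* §3 ★★★ `hFlat_of_letter` — THE REGISTERED LETTER VERBATIM (the third hypothesis `hFlat` of ✓`…S2BetaGapOrbitOfStrata.uniformFibreGapOrbit_of_strata_of_flat`, the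
  conclusion of ✓p815840 `hFlat_of_inIterTube` ∕ ✓p813841 `hFlat_of_inTube`) from (H) stated in the ENTRY's quantifier order (`∀ L > 1, ∃ δ > 0, ∃ C > 0,
  ∀ b₀ p₀, ∃ E, ∃ γ₁ > 0, ∀ F γ J < K, ∀ U ∈ fibre(1) ∩ histGood` with every level `δ`-small, `∀ g` with the tower facts, the ℓ² letter) and a lift
  family with (R1): `hFlat_of_inIterTube` ∘ `dockB_inner`; block sizes `L ≤ 1` are vacuous (`T3Family.hL`).

WHERE THE BRICKS DOCK (read off (H); none of it is proved here): `(π∕2)‖dist1(U′_j·V_j⁻¹)‖₂` ⟸ px13 g22 ✓p815925 `…RelativeFieldLetter` (interior∕face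
letters in sum currency, `hax` = (T4) VERBATIM, spine quotient via (T5) + ✓`axialAvg_lift`) + the slot multiplicity count ((ii-b)₄, px13) ⟹ `C_R·(‖dist1 U′_j(∂·)‖₂
+ ‖dist1 V_j(∂·)‖₂ + ‖dist1 corr‖₂)`; `‖dist1 V_j(∂·)‖₂` ⟸ px12 g23 (ii-c) `dist1_plaqHol_lift_le` (LOCAL σ: `(L⁻¹)²·(F + 24σ²)`, SIZE × ARC in ℓ² → the
`√L·e_j·B_{j+1}` slot with `e_j ≍ C(L)·s_{j+1}`, `Σ s_t < ∞` by px10 g21 ✓p814387 — px10∕px12's remark: feed the LEVEL PROFILE, not the uniform `δ`);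
`‖dist1 U′_j(∂·)‖₂ = ‖dist1 (M^jU)(∂·)‖₂` (conjugation) ⟸ KEY LEMMA `≤ K·(√L)^j·‖dist1 U(∂·)‖₂` (px8 g21 §64: seven files + G8 Schur + the (C)-assembler's
torus counts).  So (H) is EXACTLY {(ii-b)+(ii-b)₄, (ii-c) in ℓ², corr letter, KEY LEMMA}, and nothing else stands between the landed bricks and `hFlat`.
THE FOUR FEEDERS OF (H), BY NAME (px8 g21 07:59:16Z READ PASS, the designer's map; ✓ = landed, ⧗ = pending at filing time):
(F1) the (C)-ASSEMBLY on the torus — KEY LEMMA `‖dist1 (M^jU)(∂·)‖₂ ≤ K·(√L)^j·‖dist1 U(∂·)‖₂`: ✓p814025 `…EmlMemberTransportMean` · ✓p814285 `…EmlMemberTransportMeanContext`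
  · ✓p816098 `…EmlMemberFluctuation` (iii-a♯) · ✓p814602 `…MlogMixedDifference` (G4) · ✓p814777 `…CouplingIdentity` (G5) · ✓p815864 `…CouplingCost` (G6) · ✓p815896
  `…TentCoverage` (G7) · ✓p816252 `…SchurTest` (G8) · G9∕G10 ⧗ (px8 g21) · ✓p814030 `…CornerSquareStokes` (px21) · ✓p814080 (px13 §C) · the `T_t` torus counts (→ px12);
(F2) the (ii-b) ℓ²-ASSEMBLY — ✓p815925 `…RelativeFieldLetter` (interior∕face letters, `hax` = (T4)) · ✓p815833 `…StaircaseSlotStokes` · ✓p815834 `…ArcBondSplit` · (ii-b)₄ «slot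
  double counting» ⧗ (px13 g22);
(F3) the (ii-c) FLAP LETTER IN ℓ² — ✓p816227 `…WhitneyHatLiftCurvature.dist1_plaqHol_lift_le` (LOCAL σ; SIZE × ARC) · ✓p816181 · ✓p816182 · fed by the CONTRACTING sizes of the
  stage tower ✓p816141 `…ContractingSupRecursion` (px16 g20 (5)) — NOT the flat iterated-axial profile (px16's finding, px8's 07:45:40Z erratum) — into the `√L·e_j·B_{j+1}` slot;
(F4) the CORR LETTER IN ℓ² — ✓p812922 `…ExpMeanLogLipschitz` ((γ)-lite) ∕ lit ✓`dist1_corr_le_two_mul` class, docked through ✓p815925 `dist1_axialAvg_mul_inv_eq_corr` + (T5) +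
  ✓p815895 `axialAvg_lift`.

HONEST SCOPE.  Quantifier∕ℓ² plumbing over landed theorems, by name; (H) is an undischarged HYPOTHESIS carrying ALL of the road's analytic content;
nothing of Bałaban's analysis is asserted or proved ([Balaban1984PropagatorsI] Prop. 1.1 (1.89)–(1.90) p.33 ∕ [Balaban1984PropagatorsII] Prop. 2.2 (2.67)
p.234 are the printed loci of the quadratic floor, RULING №75; [Balaban1985RegularSpaces] (1.29) p.81 the geodesic interpolation); `hFlat`, TUBE-REG∘, GAP♯∘
(`stub_uniformFibreGapOrbit`), EXW∘, DET-REP-B, S2β, crux 20520, 19936, 19200 and `YM3TorusSU2` are NOT proved; no registered stub is closed; rung R3 =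
SU(2) YM₃ on T³ at fixed lattice data — NOT d = 4, NOT infinite volume, NOT a mass gap, NOT Clay; the Yang–Mills mass gap is NOT proved.
References: T. Bałaban, CMP **95** (1984) 17–40 [Balaban1984PropagatorsI]; CMP **96** (1984) 223–250 [Balaban1984PropagatorsII]; CMP **99** (1985) 75–102
[Balaban1985RegularSpaces]; CMP **102** (1985) 277–309 [Balaban1985Variational] ((4) p.278, (16)–(18) p.280).
-/

set_option autoImplicit false

noncomputable section

namespace Summit.QuantumFields.YangMills.Theorems.FluctuationComparisonRegPrIntLS2BetaHFlatOfRelativeLetter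

open Finset
open scoped Real
open Literature.MathematicalPhysics.QuantumLattice (su2Quat)
open Literature.MathematicalPhysics.QuantumFieldTheory.Balaban1983to89
open T4Continuum T3ContinuumYM3Torus T3UnitScaleTilt T3TiltDescent T3LevelShift BlockAveraging
open T4CubeChartGnomonic (SU2)
open T4ExpWindowSmallField (logVec)
open T3UnitLawDensityEML (ℰp)
open T3ConstrainedMinimiser (fibre)
open T3PrintedRegularMinimiser (minActionRegPr minActionRegPr_one)
open B10Eq27TorusAxialLog (axialT)
open Summit.QuantumFields.YangMills.Theorems.FluctuationComparisonRegPrIntLS2BetaStageGaugeTower (exists_stageGaugeTower)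
open Summit.QuantumFields.YangMills.Theorems.FluctuationComparisonRegPrIntLS2BetaArcBondSplit (sqrt_sum_sq_norm_logVec_le)
open Summit.QuantumFields.YangMills.Theorems.FluctuationComparisonRegPrIntLS2BetaSqrtLRecursion (recursion_varRatio_sqrtL_le hFlat_currency_of_recursion')
open Summit.QuantumFields.YangMills.Theorems.FluctuationComparisonRegPrIntLS2BetaGeodesicJensenLift (dist1_le_norm_logVec)
open Summit.QuantumFields.YangMills.Theorems.FluctuationComparisonRegPrIntLS2BetaWhitneyHatLift (logVec_su2Quat_one)
open Summit.QuantumFields.YangMills.Theorems.FluctuationComparisonRegPrIntLS2BetaFlatTubeDepthOneUniformTorus (sum_dist1_sq_plaq_le_four_mul_wilsonAction4)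
open Summit.QuantumFields.YangMills.Theorems.FluctuationComparisonRegPrIntLS2BetaIterAxialGaugeSup (iter_eq_one_of_mem_fibre_one)

open scoped Matrix.Norms.L2Operator

variable (F : T3Family) {J K : ℕ} (hJK : J ≤ K)

/-! ## §1 EXIT -/

/-- **EXIT-1**: a fine gauge whose `(K−J)`-fold average acts trivially on EVERY field is residual for `D_{J,K}` (print's group (4); `D_{J,K} = fieldShift ∘ M^{K−J}`,
✓`descendTo_eq_fieldShift_iter`). [cite: Balaban1985Variational, (4) p.278; Balaban1987RG1, (0.11) p.253] -/
theorem residual_of_iter_eq (v : Site (F.P K) 0 → SU2)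
    (hv : ∀ X : GaugeField (F.P K) 0 SU2,
      Averaging.iter (fun k => blockAvg (P := F.P K) (j := k) ℰp) (K - J) (GaugeField.gaugeAct v X) =
        Averaging.iter (fun k => blockAvg (P := F.P K) (j := k) ℰp) (K - J) X) :
    ∀ X : GaugeField (F.P K) 0 SU2, descendTo F ℰp J K hJK (GaugeField.gaugeAct v X) = descendTo F ℰp J K hJK X := by
  intro X
  rw [Prop7DescendJunction.descendTo_eq_fieldShift_iter, Prop7DescendJunction.descendTo_eq_fieldShift_iter, hv X]

/-- **EXIT-2**: the comparison transformation `g₀⁻¹` turns the orbit summand into the gauged bond: `dist1 (U ℓ · ((g₀⁻¹ • 1) ℓ)⁻¹) = dist1 ((g₀ • U) ℓ)`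
(conjugation invariance of `dist1`). [cite: Balaban1985Averaging, (8) p.19] -/
theorem dist1_mul_inv_gaugeAct_one (U : GaugeField (F.P K) 0 SU2) (g₀ : Site (F.P K) 0 → SU2) (ℓ : PBond (F.P K) 0) :
    dist1 (U ℓ * ((GaugeField.gaugeAct (fun x => (g₀ x)⁻¹) (1 : GaugeField (F.P K) 0 SU2)) ℓ)⁻¹) = dist1 (GaugeField.gaugeAct g₀ U ℓ) := by
  have e : U ℓ * ((GaugeField.gaugeAct (fun x => (g₀ x)⁻¹) (1 : GaugeField (F.P K) 0 SU2)) ℓ)⁻¹ =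
      (g₀ ℓ.src)⁻¹ * GaugeField.gaugeAct g₀ U ℓ * ((g₀ ℓ.src)⁻¹)⁻¹ := by
    show U ℓ * ((g₀ ℓ.src)⁻¹ * 1 * ((g₀ ℓ.tgt)⁻¹)⁻¹)⁻¹ = (g₀ ℓ.src)⁻¹ * (g₀ ℓ.src * U ℓ * (g₀ ℓ.tgt)⁻¹) * ((g₀ ℓ.src)⁻¹)⁻¹
    group
  rw [e, GaugeGroup.dist1_conj]

/-- ★ **EXIT-3**: the REGISTERED orbit infimum (v11.4 `UniformFibreGapOrbit` ∕ (D10)'s `hFlat` left side) is at most the ARC energy `Σ_ℓ arc((g₀ • U) ℓ)²` of the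
gauged finest field, for any `g₀` whose inverse is residual (`ciInf_le` at `g₀⁻¹`, EXIT-2, chord ≤ arc ✓`dist1_le_norm_logVec`). [cite: Balaban1985Variational, (4) p.278; Balaban1985RegularSpaces, (1.29) p.81] -/
theorem iInf_orbit_le_sum_sq_arc (U : GaugeField (F.P K) 0 SU2) (g₀ : Site (F.P K) 0 → SU2)
    (hres : ∀ X : GaugeField (F.P K) 0 SU2, descendTo F ℰp J K hJK (GaugeField.gaugeAct (fun x => (g₀ x)⁻¹) X) = descendTo F ℰp J K hJK X) :
    (⨅ w : {w : Site (F.P K) 0 → SU2 | ∀ X : GaugeField (F.P K) 0 SU2, descendTo F ℰp J K hJK (GaugeField.gaugeAct w X) = descendTo F ℰp J K hJK X},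
      ∑ ℓ : PBond (F.P K) 0, dist1 (U ℓ * ((GaugeField.gaugeAct (w : Site (F.P K) 0 → SU2) (1 : GaugeField (F.P K) 0 SU2)) ℓ)⁻¹) ^ 2) ≤
    ∑ ℓ : PBond (F.P K) 0, ‖logVec (su2Quat (GaugeField.gaugeAct g₀ U ℓ))‖ ^ 2 := by
  refine le_trans (ciInf_le ⟨0, ?_⟩ (⟨fun x => (g₀ x)⁻¹, hres⟩ :
      {w : Site (F.P K) 0 → SU2 | ∀ X : GaugeField (F.P K) 0 SU2, descendTo F ℰp J K hJK (GaugeField.gaugeAct w X) = descendTo F ℰp J K hJK X})) ?_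
  · rintro _ ⟨v, rfl⟩
    exact sum_nonneg fun _ _ => sq_nonneg _
  · refine sum_le_sum fun ℓ _ => ?_
    rw [dist1_mul_inv_gaugeAct_one]
    exact pow_le_pow_left₀ (GaugeGroup.dist1_nonneg _) (dist1_le_norm_logVec _) 2

/-! ## §2 The (B) recursion end to end, one run pair, with the relative letter (H) displayed -/

/-- ★★★ **DOCK-B, INNER FORM** (one run pair `J < K`, one good history `U` over the flat datum, the (0.4) average, ANY lift with px12's (R1)).
HYPOTHESIS (H) = «THE ONE-LEVEL RELATIVE LETTER IN ℓ²»: for EVERY gauge family `g` with the stage tower's (T1) top, (T2) nesting, (T4) comb axiality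
relative to `lift j (g_{j+1} • M^{j+1}U)` and (T5) one-step consistency, there is a profile `e ≥ 0` with `Σ_{j<K−J} e_j ≤ E` such that at every level
`(π∕2)·‖dist1 (U′_j · V_j⁻¹)‖_{ℓ²} ≤ √L·e_j·‖arc U′_{j+1}‖_{ℓ²} + C·(√L)^j·‖dist1 (U ∂·)‖_{ℓ²}` — this is where (ii-b) (✓p815925) + its slot count
+ the flap letter (px12 (ii-c)) + the corr letter + the KEY LEMMA (px8 (C)) dock.  CONCLUSION: the in-tube `hFlat` inequality with the EXPLICIT
`μ = ((L−1)∕(exp E·C))²∕4`. [cite: Balaban1985RegularSpaces, (1.29) p.81; Balaban1984PropagatorsI, Prop. 1.1 (1.89)-(1.90) p.33] -/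
theorem dockB_inner (hlt : J < K) (hL : 1 < (F.L : ℝ)) {ε₀ : ℝ} (hε₀ : 0 < ε₀)
    (U : GaugeField (F.P K) 0 SU2) (hUf : U ∈ fibre F ℰp J K hlt.le (1 : GaugeField (F.P J) 0 SU2))
    (lift : (j : ℕ) → GaugeField (F.P K) (j + 1) SU2 → GaugeField (F.P K) j SU2)
    (hW2 : ∀ j, j < K - J → ∀ X : GaugeField (F.P K) (j + 1) SU2,
      ∑ b, ‖logVec (su2Quat (lift j X b))‖ ^ 2 ≤ (F.L : ℝ) * ∑ e, ‖logVec (su2Quat (X e))‖ ^ 2)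
    (C E : ℝ) (hC : 0 < C)
    (H : ∀ g : (j : ℕ) → Site (F.P K) j → SU2,
      (∀ j, j < K - J → ∀ x, g j x =
        (axialT (lift j (GaugeField.gaugeAct (g (j + 1)) (Averaging.iter (fun k => blockAvg (P := F.P K) (j := k) ℰp) (j + 1) U)))
            (emb (blockOf x)) x)⁻¹ *
          g (j + 1) (blockOf x) * axialT (Averaging.iter (fun k => blockAvg (P := F.P K) (j := k) ℰp) j U) (emb (blockOf x)) x) →
      (∀ j, K - J ≤ j → ∀ y, g j y = 1) →
      (∀ j, j < K - J → ∀ y : Site (F.P K) (j + 1), g j (emb y) = g (j + 1) y) →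
      (∀ X : GaugeField (F.P K) 0 SU2, ∀ j, j ≤ K - J →
        Averaging.iter (fun k => blockAvg (P := F.P K) (j := k) ℰp) j (GaugeField.gaugeAct (g 0) X) =
          GaugeField.gaugeAct (g j) (Averaging.iter (fun k => blockAvg (P := F.P K) (j := k) ℰp) j X)) →
      (∀ j, j < K - J → ∀ x,
        axialT (GaugeField.gaugeAct (g j) (Averaging.iter (fun k => blockAvg (P := F.P K) (j := k) ℰp) j U)) (emb (blockOf x)) x =
          axialT (lift j (GaugeField.gaugeAct (g (j + 1)) (Averaging.iter (fun k => blockAvg (P := F.P K) (j := k) ℰp) (j + 1) U)))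
            (emb (blockOf x)) x) →
      (∀ j, j < K - J →
        (blockAvg (P := F.P K) (j := j) ℰp).avg (GaugeField.gaugeAct (g j) (Averaging.iter (fun k => blockAvg (P := F.P K) (j := k) ℰp) j U)) =
          GaugeField.gaugeAct (g (j + 1)) (Averaging.iter (fun k => blockAvg (P := F.P K) (j := k) ℰp) (j + 1) U)) →
      ∃ e : ℕ → ℝ, (∀ j, 0 ≤ e j) ∧ ∑ j ∈ range (K - J), e j ≤ E ∧
        ∀ j, j < K - J →
          π / 2 * √(∑ b, dist1 (GaugeField.gaugeAct (g j) (Averaging.iter (fun k => blockAvg (P := F.P K) (j := k) ℰp) j U) b *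
              (lift j (GaugeField.gaugeAct (g (j + 1)) (Averaging.iter (fun k => blockAvg (P := F.P K) (j := k) ℰp) (j + 1) U)) b)⁻¹) ^ 2) ≤
            Real.sqrt (F.L : ℝ) * e j *
                √(∑ b, ‖logVec (su2Quat (GaugeField.gaugeAct (g (j + 1)) (Averaging.iter (fun k => blockAvg (P := F.P K) (j := k) ℰp) (j + 1) U) b))‖ ^ 2) +
              C * Real.sqrt (F.L : ℝ) ^ j * √(∑ p, dist1 (GaugeField.plaqHol U p) ^ 2)) :
    ((F.L - 1) / (Real.exp E * C)) ^ 2 / 4 * ((F.L : ℝ)⁻¹) ^ (2 * (K - J)) *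
        (⨅ w : {w : Site (F.P K) 0 → SU2 | ∀ X : GaugeField (F.P K) 0 SU2,
            descendTo F ℰp J K hlt.le (GaugeField.gaugeAct w X) = descendTo F ℰp J K hlt.le X},
          ∑ ℓ : PBond (F.P K) 0, dist1 (U ℓ * ((GaugeField.gaugeAct (w : Site (F.P K) 0 → SU2) (1 : GaugeField (F.P K) 0 SU2)) ℓ)⁻¹) ^ 2) ≤
      wilsonAction4 U - minActionRegPr F J K hlt.le ε₀ (1 : GaugeField (F.P J) 0 SU2) := by
  have hm : K - J ≤ (F.P K).m + (F.P K).K := by show K - J ≤ F.m + K; omega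
  set av : ∀ i, Averaging (F.P K) i SU2 := fun k => blockAvg (P := F.P K) (j := k) ℰp with hav
  -- the stage tower
  obtain ⟨g, hT0, hT1, hT2, hT3, hres, hT6, hT4, hT5⟩ := exists_stageGaugeTower av hm lift U
  -- the letter's profile
  obtain ⟨e, he0, heE, hH⟩ := H g hT0 hT1 hT2 hT3 hT4 hT5
  -- the level energies
  set B : ℕ → ℝ := fun j => √(∑ b, ‖logVec (su2Quat (GaugeField.gaugeAct (g j) (Averaging.iter av j U) b))‖ ^ 2) with hB
  set Fl : ℝ := √(∑ p, dist1 (GaugeField.plaqHol U p) ^ 2) with hFl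
  have hFl0 : 0 ≤ Fl := Real.sqrt_nonneg _
  have hB0 : ∀ j, 0 ≤ B j := fun j => Real.sqrt_nonneg _
  -- top: `U′_{K−J} = 1`
  have htop : B (K - J) = 0 := by
    have h1 : Averaging.iter av (K - J) U = 1 := iter_eq_one_of_mem_fibre_one F hlt.le hUf
    have hg : g (K - J) = fun _ => 1 := funext (hT1 (K - J) le_rfl)
    simp only [hB, h1, hg, T4AxialGaugeFixing.gaugeAct_const_one]
    have : ∀ b : PBond (F.P K) (K - J), ‖logVec (su2Quat ((1 : GaugeField (F.P K) (K - J) SU2) b))‖ ^ 2 = 0 := fun b => by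
      show ‖logVec (su2Quat (1 : SU2))‖ ^ 2 = 0
      rw [logVec_su2Quat_one, norm_zero]; ring
    simp only [this, sum_const_zero, Real.sqrt_zero]
  -- the one-level recursion
  have hrec : ∀ j, j < K - J → B j ≤ Real.sqrt (F.L : ℝ) * (1 + e j) * B (j + 1) + C * Real.sqrt (F.L : ℝ) ^ j * Fl := by
    intro j hj
    have hsplit := sqrt_sum_sq_norm_logVec_le (univ : Finset (PBond (F.P K) j))
      (fun b => GaugeField.gaugeAct (g j) (Averaging.iter av j U) b)
      (fun b => lift j (GaugeField.gaugeAct (g (j + 1)) (Averaging.iter av (j + 1) U)) b)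
    have hlift : √(∑ b, ‖logVec (su2Quat (lift j (GaugeField.gaugeAct (g (j + 1)) (Averaging.iter av (j + 1) U)) b))‖ ^ 2) ≤
        Real.sqrt (F.L : ℝ) * B (j + 1) := by
      rw [hB, ← Real.sqrt_mul (by positivity)]
      exact Real.sqrt_le_sqrt (hW2 j hj _)
    have hHj := hH j hj
    have hLs : 0 ≤ Real.sqrt (F.L : ℝ) := Real.sqrt_nonneg _
    calc B j ≤ √(∑ b, ‖logVec (su2Quat (lift j (GaugeField.gaugeAct (g (j + 1)) (Averaging.iter av (j + 1) U)) b))‖ ^ 2) +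
          π / 2 * √(∑ b, dist1 (GaugeField.gaugeAct (g j) (Averaging.iter av j U) b *
            (lift j (GaugeField.gaugeAct (g (j + 1)) (Averaging.iter av (j + 1) U)) b)⁻¹) ^ 2) := hsplit
      _ ≤ Real.sqrt (F.L : ℝ) * B (j + 1) + (Real.sqrt (F.L : ℝ) * e j * B (j + 1) + C * Real.sqrt (F.L : ℝ) ^ j * Fl) :=
          add_le_add hlift hHj
      _ = Real.sqrt (F.L : ℝ) * (1 + e j) * B (j + 1) + C * Real.sqrt (F.L : ℝ) ^ j * Fl := by ring
  -- px16's variable-ratio recursion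
  have hsol := recursion_varRatio_sqrtL_le (F.L : ℝ) hL B (fun j => C * Real.sqrt (F.L : ℝ) ^ j * Fl) e (K - J) htop he0 E heE
    hrec C Fl hC.le hFl0 (fun t _ => le_rfl)
  -- in the registered currency
  have hC' : 0 < Real.exp E * C := mul_pos (Real.exp_pos E) hC
  have hL1 : 0 < (F.L : ℝ) - 1 := by linarith
  have hsol' : B 0 ≤ Real.exp E * C * Fl * ((F.L : ℝ) ^ (K - J) / ((F.L : ℝ) - 1)) := by
    refine hsol.trans (mul_le_mul_of_nonneg_left (div_le_div_of_nonneg_right (by linarith) hL1.le) ?_)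
    exact mul_nonneg hC'.le hFl0
  have hcur := hFlat_currency_of_recursion' (F.L : ℝ) (Real.exp E * C) Fl (B 0) (K - J) hL hC' (hB0 0) hsol'
  -- EXIT
  have hresD := residual_of_iter_eq F hlt.le (fun x => (g 0 x)⁻¹) hT6
  have hexit := iInf_orbit_le_sum_sq_arc F hlt.le U (g 0) hresD
  have hB0sq : (∑ ℓ : PBond (F.P K) 0, ‖logVec (su2Quat (GaugeField.gaugeAct (g 0) U ℓ))‖ ^ 2) = B 0 ^ 2 := by
    rw [hB, Real.sq_sqrt (sum_nonneg fun _ _ => sq_nonneg _)]; rfl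
  have hFl2 : Fl ^ 2 ≤ 4 * wilsonAction4 U := by
    rw [hFl, Real.sq_sqrt (sum_nonneg fun _ _ => sq_nonneg _)]
    exact sum_dist1_sq_plaq_le_four_mul_wilsonAction4 U
  have hmin : minActionRegPr F J K hlt.le ε₀ (1 : GaugeField (F.P J) 0 SU2) = 0 := minActionRegPr_one F hε₀
  rw [hmin, sub_zero]
  have hiInf0 : 0 ≤ (⨅ w : {w : Site (F.P K) 0 → SU2 | ∀ X : GaugeField (F.P K) 0 SU2,
            descendTo F ℰp J K hlt.le (GaugeField.gaugeAct w X) = descendTo F ℰp J K hlt.le X},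
          ∑ ℓ : PBond (F.P K) 0, dist1 (U ℓ * ((GaugeField.gaugeAct (w : Site (F.P K) 0 → SU2) (1 : GaugeField (F.P K) 0 SU2)) ℓ)⁻¹) ^ 2) := by
    haveI : Nonempty {w : Site (F.P K) 0 → SU2 | ∀ X : GaugeField (F.P K) 0 SU2,
        descendTo F ℰp J K hlt.le (GaugeField.gaugeAct w X) = descendTo F ℰp J K hlt.le X} := ⟨⟨fun x => (g 0 x)⁻¹, hresD⟩⟩
    exact le_ciInf fun w => sum_nonneg fun _ _ => sq_nonneg _
  have hpow0 : 0 ≤ ((F.L : ℝ)⁻¹) ^ (2 * (K - J)) := by positivity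
  calc ((F.L - 1) / (Real.exp E * C)) ^ 2 / 4 * ((F.L : ℝ)⁻¹) ^ (2 * (K - J)) * _
      ≤ ((F.L - 1) / (Real.exp E * C)) ^ 2 / 4 * ((F.L : ℝ)⁻¹) ^ (2 * (K - J)) * B 0 ^ 2 := by
        refine mul_le_mul_of_nonneg_left (hexit.trans_eq hB0sq) (by positivity)
    _ = (((F.L - 1) / (Real.exp E * C)) ^ 2 * ((F.L : ℝ)⁻¹) ^ (2 * (K - J)) * B 0 ^ 2) / 4 := by ring
    _ ≤ Fl ^ 2 / 4 := div_le_div_of_nonneg_right hcur (by norm_num)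
    _ ≤ wilsonAction4 U := by linarith


/-! ## §3 The outer wrapper: the letter (H) in hTube's quantifier order gives hFlat VERBATIM (✓p815840 `hFlat_of_inIterTube`) -/

/-- ★★★ **DOCK-B, OUTER FORM**: if for every block size `L > 1` there are a tube radius `δ > 0` and a constant `C > 0`, and for every profile `(b₀, p₀)` a
budget `E ≥ 0` and a coupling threshold `γ₁ > 0`, such that the ONE-LEVEL RELATIVE LETTER (H) holds for every good history over the flat datum all of
whose levels are bondwise `δ`-small (with a lift satisfying px12's (R1) at `d = 3`), then the registered `hFlat` letter holds VERBATIM (third hypothesis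
of ✓`…S2BetaGapOrbitOfStrata.uniformFibreGapOrbit_of_strata_of_flat`), with `μ = ((L−1)∕(exp E·C))²∕4`.
[cite: Balaban1984PropagatorsI, Prop. 1.1 (1.89)-(1.90) p.33; Balaban1984PropagatorsII, Prop. 2.2 (2.67) p.234; Balaban1985RegularSpaces, (1.29) p.81] -/
theorem hFlat_of_letter
    (lift : (F : T3Family) → (K j : ℕ) → GaugeField (F.P K) (j + 1) SU2 → GaugeField (F.P K) j SU2)
    (hW2 : ∀ (F : T3Family) (K J j : ℕ), j < K - J → ∀ X : GaugeField (F.P K) (j + 1) SU2,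
      ∑ b, ‖logVec (su2Quat (lift F K j X b))‖ ^ 2 ≤ (F.L : ℝ) * ∑ e, ‖logVec (su2Quat (X e))‖ ^ 2)
    (HL : ∀ (L : ℕ), 1 < L → ∃ δ : ℝ, 0 < δ ∧ ∃ C : ℝ, 0 < C ∧ ∀ (b₀ p₀ : ℝ), 0 < b₀ → 0 < p₀ → ∃ E : ℝ,
      ∃ γ₁ : ℝ, 0 < γ₁ ∧ ∀ (F : T3Family) (γ : ℝ), F.L = L → 0 < γ → γ ≤ γ₁ →
        ∀ (J K : ℕ) (hlt : J < K),
          ∀ U ∈ fibre F ℰp J K hlt.le (1 : GaugeField (F.P J) 0 SU2), U ∈ histGood F ℰp (θBal F.L γ b₀ p₀) K J →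
            (∀ j, j ≤ K - J → ∀ b : PBond (F.P K) j, dist1 (Averaging.iter (fun k => blockAvg (P := F.P K) (j := k) ℰp) j U b) ≤ δ) →
            ∀ g : (j : ℕ) → Site (F.P K) j → SU2,
              (∀ j, j < K - J → ∀ x, g j x =
                (axialT (lift F K j (GaugeField.gaugeAct (g (j + 1)) (Averaging.iter (fun k => blockAvg (P := F.P K) (j := k) ℰp) (j + 1) U)))
                    (emb (blockOf x)) x)⁻¹ *
                  g (j + 1) (blockOf x) * axialT (Averaging.iter (fun k => blockAvg (P := F.P K) (j := k) ℰp) j U) (emb (blockOf x)) x) →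
              (∀ j, K - J ≤ j → ∀ y, g j y = 1) →
              (∀ j, j < K - J → ∀ y : Site (F.P K) (j + 1), g j (emb y) = g (j + 1) y) →
              (∀ X : GaugeField (F.P K) 0 SU2, ∀ j, j ≤ K - J →
                Averaging.iter (fun k => blockAvg (P := F.P K) (j := k) ℰp) j (GaugeField.gaugeAct (g 0) X) =
                  GaugeField.gaugeAct (g j) (Averaging.iter (fun k => blockAvg (P := F.P K) (j := k) ℰp) j X)) →
              (∀ j, j < K - J → ∀ x,
                axialT (GaugeField.gaugeAct (g j) (Averaging.iter (fun k => blockAvg (P := F.P K) (j := k) ℰp) j U)) (emb (blockOf x)) x =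
                  axialT (lift F K j (GaugeField.gaugeAct (g (j + 1)) (Averaging.iter (fun k => blockAvg (P := F.P K) (j := k) ℰp) (j + 1) U)))
                    (emb (blockOf x)) x) →
              (∀ j, j < K - J →
                (blockAvg (P := F.P K) (j := j) ℰp).avg (GaugeField.gaugeAct (g j) (Averaging.iter (fun k => blockAvg (P := F.P K) (j := k) ℰp) j U)) =
                  GaugeField.gaugeAct (g (j + 1)) (Averaging.iter (fun k => blockAvg (P := F.P K) (j := k) ℰp) (j + 1) U)) →
              ∃ e : ℕ → ℝ, (∀ j, 0 ≤ e j) ∧ ∑ j ∈ range (K - J), e j ≤ E ∧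
                ∀ j, j < K - J →
                  π / 2 * √(∑ b, dist1 (GaugeField.gaugeAct (g j) (Averaging.iter (fun k => blockAvg (P := F.P K) (j := k) ℰp) j U) b *
                      (lift F K j (GaugeField.gaugeAct (g (j + 1)) (Averaging.iter (fun k => blockAvg (P := F.P K) (j := k) ℰp) (j + 1) U)) b)⁻¹) ^ 2) ≤
                    Real.sqrt (F.L : ℝ) * e j *
                        √(∑ b, ‖logVec (su2Quat (GaugeField.gaugeAct (g (j + 1))
                          (Averaging.iter (fun k => blockAvg (P := F.P K) (j := k) ℰp) (j + 1) U) b))‖ ^ 2) +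
                      C * Real.sqrt (F.L : ℝ) ^ j * √(∑ p, dist1 (GaugeField.plaqHol U p) ^ 2)) :
    ∀ (L : ℕ), ∃ pS : ℝ, ∀ (b₀ p₀ : ℝ), 0 < b₀ → pS ≤ p₀ → 0 < p₀ → ∃ ε₁ : ℝ, 0 < ε₁ ∧ ∀ (ε₀ : ℝ), 0 < ε₀ → ε₀ ≤ ε₁ →
    ∃ γ₁ : ℝ, 0 < γ₁ ∧ ∃ μ : ℝ, 0 < μ ∧ ∀ (F : T3Family) (γ : ℝ), F.L = L → 0 < γ → γ ≤ γ₁ →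
      ∀ (J K : ℕ) (hlt : J < K),
        ∀ U ∈ fibre F ℰp J K hlt.le (1 : GaugeField (F.P J) 0 SU2), U ∈ histGood F ℰp (θBal F.L γ b₀ p₀) K J →
          μ * ((F.L : ℝ)⁻¹) ^ (2 * (K - J)) *
              (⨅ w : {w : Site (F.P K) 0 → SU2 |
                  ∀ U : GaugeField (F.P K) 0 SU2,
                    descendTo F ℰp J K hlt.le (GaugeField.gaugeAct w U) = descendTo F ℰp J K hlt.le U},
                ∑ ℓ : PBond (F.P K) 0,
                  dist1 (U ℓ * ((GaugeField.gaugeAct (w : Site (F.P K) 0 → SU2) (1 : GaugeField (F.P K) 0 SU2)) ℓ)⁻¹) ^ 2)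
            ≤ wilsonAction4 U - minActionRegPr F J K hlt.le ε₀ (1 : GaugeField (F.P J) 0 SU2) := by
  refine FluctuationComparisonRegPrIntLS2BetaIterFlatTubeWLOG.hFlat_of_inIterTube fun L => ?_
  by_cases hL : 1 < L
  · obtain ⟨δ, hδ, C, hC, hrest⟩ := HL L hL
    refine ⟨δ, hδ, 0, fun b₀ p₀ hb _ hp => ⟨1, one_pos, fun ε₀ hε₀ _ => ?_⟩⟩
    obtain ⟨E, γ₁, hγ₁, hmain⟩ := hrest b₀ p₀ hb hp
    refine ⟨γ₁, hγ₁, ((L - 1 : ℝ) / (Real.exp E * C)) ^ 2 / 4, ?_, fun F γ hFL hγ hγ1 J K hlt U hUf hUg hδU => ?_⟩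
    · have hL' : (1 : ℝ) < L := by exact_mod_cast hL
      have : 0 < (L - 1 : ℝ) / (Real.exp E * C) := div_pos (by linarith) (mul_pos (Real.exp_pos E) hC)
      positivity
    · have hFL' : (F.L : ℝ) = L := by exact_mod_cast hFL
      have hLF : 1 < (F.L : ℝ) := by rw [hFL']; exact_mod_cast hL
      have h := dockB_inner F hlt hLF hε₀ U hUf (lift F K) (fun j hj X => hW2 F K J j hj X) C E hC
        (fun g h0 h1 h2 h3 h4 h5 => hmain F γ hFL hγ hγ1 J K hlt U hUf hUg hδU g h0 h1 h2 h3 h4 h5)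
      rw [hFL'] at h ⊢
      exact h
  · -- block sizes `L ≤ 1` carry no `T3Family` with `1 < F.L`: vacuous
    refine ⟨1, one_pos, 0, fun b₀ p₀ _ _ _ => ⟨1, one_pos, fun ε₀ _ _ => ⟨1, one_pos, 1, one_pos, fun F γ hFL => ?_⟩⟩⟩
    exact absurd (hFL ▸ F.hL.2) hL

end Summit.QuantumFields.YangMills.Theorems.FluctuationComparisonRegPrIntLS2BetaHFlatOfRelativeLetter

end
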